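import Literature.MathematicalPhysics.QuantumFieldTheory.Balaban1983to89.Beta.ScalarBlockKKT

/-!
# `Balaban1983to89.Beta.BiLaplaceBlockKKT` — THE BLOCK-SUM-CONSTRAINED INVERSE OF THE SQUARED LAPLACIAN ON `ℤ^{d+1}`
(the U = 1, sharp-constraint, infinite-volume analogue of the scalar operator `𝒮` of the Landau-type block gauge):
Bloch fibres, nonsingularity at every real momentum, the fundamental solution, and the KERNEL `Sb` with its identities
and decay at fixed `N` (β sub-cell row BETA-an2, unit `b2b-balaban-beta-an2` gen 6; AN2.md §15.4 brick (G″))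

HONEST FRAMING (cell `pub-balaban`, verbatim): discharging `BetaPertH` makes Bałaban's UV stability UNCONDITIONAL — a
real constructive-QFT result; it is NOT the continuum limit and NOT the Clay problem.  This module is [folklore] lattice
linear algebra on landed machinery; it asserts NOTHING about Bałaban's papers, contains no `def … : Prop` fact, cites
no published theorem as a hypothesis, and is NOT summit progress.  ABSOLUTE RULE honoured: nothing is cited; everything
is proved.  (Which printed operator this kernel is read against — the constrained inverse of `Δ²` entering the
projection `R = Δ𝒮Δ` of the Landau-type block gauge — is a markdown READING recorded in the cell's row file, never a
hypothesis here.)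

## What is here (the squared-Laplacian companion of `ScalarBlockKKT`)

With `L := codiff₁ ∘ dz = −Δ` on the fine lattice `ℤ^{d+1}` with blocks of side `N`, the KKT system

  (EL_b)  `L (L λ) x = ω (quo N x) + F x`      (`ω` a coarse multiplier, `F` a force),
  (M_b)   `blockSum N λ y = c y`                (prescribed block sums),

i.e. the Lagrange system of `λ ↦ ½|L λ|² − ⟨F, λ⟩` under the block-sum constraints — the constrained inverse of `L²`.
In the block coordinates `ScalarBlockKKT.IdxS d N = TorusSite d N ⊕ Unit` of the scalar brick it is again a finite-range
block-Toeplitz system over the radius-3 stencil (`L²` has fine range 2), and: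

1. `eq_zero_of_fibreLinB_eq_zero` / `det_fibreMatrixB_ne_zero`: every UNITARY Bloch fibre is nonsingular — a Bloch
   solution of the homogeneous system has `L (L λ)` constant on the box and zero box sum, hence is discrete-harmonic
   (`BlochFibreUniqueness.lap_eq_zero_of_gauge`: `⟨λ, L²λ⟩_box = 0 = ‖Lλ‖²_box`), hence `0`
   (`eq_zero_of_lap_of_bsum`), and then `ω = 0`.
2. `det_trigPolySymbolB_ne_zero`, `invKernelB_decay_l1`, `fundCfgB`, `cfgFunB_fundCfgB`: junction with `FibreInverseDecay`.
3. THE KERNEL with a unit force at a fine site: real columns `sB z₀`, `wB z₀` with `sB_EL`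
   (`L (L (sB z₀)) x = wB z₀ (quo N x) + δ_{x, repZ z₀}`), `sB_M` (zero block sums); decay at FIXED `N` (`decay_sB`,
   `decay_wB`; no uniformity in `N` claimed); arbitrary source site by block translation TAKEN AS THE DEFINITION
   `Sb x x'`, `Wb y x'` with `Sb_EL`, `Sb_M`, `decay_Sb`.

NOT here: symmetry / positivity of `Sb` (energy identity `Sb x x' = ⟨L S_x, L S_{x'}⟩`) and tempered uniqueness
(`FibreLiouville`) — routine copies of `ScalarBlockGreen`; the projection kernel `L_x L_{x'} Sb`; any `N`-uniform
estimate; anything at a non-trivial background.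
-/

namespace Literature.MathematicalPhysics.QuantumFieldTheory.Balaban1983to89.Beta.BiLaplaceBlockKKT

noncomputable section

open scoped ComplexConjugate
open Literature.Probability.LatticeModels (TorusSite Torus.proj Torus.proj_apply)
open AffineAveraging (Form0 Form1 unitVec unitVec_apply dz codiff₁ box toSite blockSum)
open LatticeForm (IsBloch repZ quo proj_repZ proj_add_zsmul)
open BlochFibreUniqueness (quo_add_zsmul quo_repZ isBloch_iff isBloch_one_iff' isBloch_sub isBloch_dz isBloch_lapN
  isBloch_blockSum isBloch_eq_zero_of_box bsum blockSum_zero_eq_bsum lap_eq_zero_of_gauge eq_zero_of_lap_of_bsum)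
open BlochFibreMatrix (stencil mem_stencil zero_mem_stencil repZ_zero Agree agree_dz agree_codiff₁ delta blochChar
  norm_blochChar_real blockSum_translate eq_repZ_add_zsmul_quo dz_add' dz_smul' codiff₁_add' codiff₁_smul'
  blockSum_add' blockSum_smul')
open FibreInverseDecay (trigPolySymbol invKernel)
open Literature.MathematicalPhysics.QuantumFieldTheory.Balaban1983to89.B4Strip (ofRealVec)
open KernelSpecInstance (re0 re0_apply re1_dz re0_codiff₁ exp_quo_le)
open KKTFluctuationKernel (l1_sub_le l1_repZ_le eq_repZ_iff blockSum_shift)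
open ScalarBlockKKT (IdxS CfgS cfgL cfgW tensS bsAdj bsAdj_apply cfgL_add cfgL_smul cfgW_add cfgW_smul tensS_add_right
  tensS_smul_right isBloch_cfgL isBloch_cfgW isBloch_bsAdj cfgL_repZ cfgW_zero agree_cfgL cfgW_zero_congr blockSumS_congr
  cfgS_eq_sum_tens_on_stencil shiftCfgS cfgL_shiftCfgS cfgW_shiftCfgS lapN_translate re0_blockSum lapN_shiftS srcS srcS_inl
  srcS_inr mulVec_srcS)
open B12Sec2to5 (l1 Decay510)

variable {d N : ℕ}

/-! ## §1 The residual of the squared-Laplacian system -/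

/-- THE RESIDUAL VECTOR of the homogeneous system on the box of the origin: EL rows `L (L λ) (repZ z) − ω 0`
(`L = codiff₁ ∘ dz`), and the M row `blockSum N λ 0`. [folklore] -/
def residB [NeZero N] (lam ω : Form0 d ℂ) : IdxS d N → ℂ := fun i =>
  match i with
  | Sum.inl z => codiff₁ (dz (codiff₁ (dz lam))) (repZ z) - ω 0
  | Sum.inr _ => blockSum N lam 0

section Resid

variable [NeZero N]

/-- EL rows of the residual. [folklore] -/
@[simp] theorem residB_inl (lam ω : Form0 d ℂ) (z : TorusSite d N) :
    residB lam ω (Sum.inl z) = codiff₁ (dz (codiff₁ (dz lam))) (repZ z) - ω 0 := rfl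

/-- The M row of the residual. [folklore] -/
@[simp] theorem residB_inr (lam ω : Form0 d ℂ) (u : Unit) :
    residB (N := N) lam ω (Sum.inr u) = blockSum N lam 0 := rfl

/-- The residual is additive. [folklore] -/
theorem residB_add (lam lam' ω ω' : Form0 d ℂ) :
    residB (N := N) (lam + lam') (ω + ω') = residB lam ω + residB lam' ω' := by
  funext i
  rcases i with z | u
  · simp only [Pi.add_apply, residB_inl, dz_add', codiff₁_add']; ring
  · simp only [Pi.add_apply, residB_inr, blockSum_add']

/-- The residual is homogeneous. [folklore] -/
theorem residB_smul (a : ℂ) (lam ω : Form0 d ℂ) :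
    residB (N := N) (a • lam) (a • ω) = a • residB lam ω := by
  funext i
  rcases i with z | u
  · simp only [Pi.smul_apply, smul_eq_mul, residB_inl, dz_smul', codiff₁_smul']; ring
  · simp only [Pi.smul_apply, smul_eq_mul, residB_inr, blockSum_smul']

/-- THE RESIDUAL OF A CONFIGURATION on the box of the origin. [folklore] -/
def cfgFunB (U : CfgS d N) : IdxS d N → ℂ := residB (cfgL U) (cfgW U)

/-- Additivity. [folklore] -/
theorem cfgFunB_add (U V : CfgS d N) : cfgFunB (U + V) = cfgFunB U + cfgFunB V := by
  simp only [cfgFunB, cfgL_add, cfgW_add, residB_add]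

/-- Homogeneity. [folklore] -/
theorem cfgFunB_smul (a : ℂ) (U : CfgS d N) : cfgFunB (a • U) = a • cfgFunB U := by
  simp only [cfgFunB, cfgL_smul, cfgW_smul, residB_smul]

/-- The zero configuration has zero residual. [folklore] -/
theorem cfgFunB_zero : cfgFunB (0 : CfgS d N) = 0 := by
  have h := cfgFunB_smul (N := N) (d := d) (0 : ℂ) 0
  rwa [zero_smul, zero_smul] at h

/-- Residual of a finite sum of configurations. [folklore] -/
theorem cfgFunB_finset_sum {ι : Type*} (s : Finset ι) (W : ι → CfgS d N) :
    cfgFunB (∑ i ∈ s, W i) = ∑ i ∈ s, cfgFunB (W i) := by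
  classical
  induction s using Finset.induction_on with
  | empty => simp only [Finset.sum_empty]; exact cfgFunB_zero
  | insert j s hj ih => rw [Finset.sum_insert hj, Finset.sum_insert hj, cfgFunB_add, ih]

end Resid

/-! ## §2 The fibre map and its matrix -/

section Fibre

variable [NeZero N]

/-- The fibre map on box coordinates. [folklore] -/
def fibreFunB (c : AffineAveraging.Site d → ℂ) (v : IdxS d N → ℂ) : IdxS d N → ℂ := cfgFunB (tensS c v)

/-- Additivity in the box data. [folklore] -/
theorem fibreFunB_add_v (c : AffineAveraging.Site d → ℂ) (v w : IdxS d N → ℂ) :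
    fibreFunB c (v + w) = fibreFunB c v + fibreFunB c w := by
  simp only [fibreFunB, tensS_add_right, cfgFunB_add]

/-- Homogeneity in the box data. [folklore] -/
theorem fibreFunB_smul_v (c : AffineAveraging.Site d → ℂ) (a : ℂ) (v : IdxS d N → ℂ) :
    fibreFunB c (a • v) = a • fibreFunB c v := by
  simp only [fibreFunB, tensS_smul_right, cfgFunB_smul]

/-- THE FIBRE MAP as a linear endomorphism. [folklore] -/
def fibreLinB (c : AffineAveraging.Site d → ℂ) : (IdxS d N → ℂ) →ₗ[ℂ] (IdxS d N → ℂ) where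
  toFun := fibreFunB c
  map_add' := fibreFunB_add_v c
  map_smul' a v := by simp only [RingHom.id_apply]; exact fibreFunB_smul_v c a v

/-- Unfolding. [folklore] -/
@[simp] theorem fibreLinB_apply (c : AffineAveraging.Site d → ℂ) (v : IdxS d N → ℂ) :
    fibreLinB c v = fibreFunB c v := rfl

/-- THE FIBRE MATRIX. [folklore] -/
def fibreMatrixB (c : AffineAveraging.Site d → ℂ) : Matrix (IdxS d N) (IdxS d N) ℂ :=
  LinearMap.toMatrix' (fibreLinB c)

/-- `fibreMatrixB c` acts as the fibre map. [folklore] -/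
theorem fibreMatrixB_mulVec (c : AffineAveraging.Site d → ℂ) (v : IdxS d N → ℂ) :
    (fibreMatrixB c).mulVec v = fibreFunB c v := by
  rw [fibreMatrixB, LinearMap.toMatrix'_mulVec, fibreLinB_apply]

end Fibre

/-! ## §3 Unitary characters: INJECTIVITY of every unitary fibre -/

section Character

variable [NeZero N] (χ : AddChar (AffineAveraging.Site d) ℂ)

/-- THE SYSTEM READ BACK ON `ℤ^d`: if `fibreLinB χ v = rhs` with `rhs` vanishing on the EL rows, the Bloch fields of
`χ ⊗ v` satisfy (EL_b) with zero force EVERYWHERE and have block sums `χ y · rhs (M row)`. [folklore] -/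
theorem solves_of_fibreLinB_eq {v rhs : IdxS d N → ℂ} (h : fibreLinB (⇑χ) v = rhs)
    (hEL0 : ∀ z, rhs (Sum.inl z) = 0) :
    (∀ x, codiff₁ (dz (codiff₁ (dz (cfgL (tensS (⇑χ) v))))) x = cfgW (tensS (⇑χ) v) (quo N x))
    ∧ (∀ y, blockSum N (cfgL (tensS (⇑χ) v)) y = χ y * rhs (Sum.inr ())) := by
  have hres : ∀ i, residB (cfgL (tensS (⇑χ) v)) (cfgW (tensS (⇑χ) v)) i = rhs i := fun i => by
    have := congrArg (fun f => f i) h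
    simpa only [fibreLinB_apply, fibreFunB, cfgFunB] using this
  set lam := cfgL (tensS (⇑χ) v) with hlamdef
  set ω := cfgW (tensS (⇑χ) v) with hωdef
  have hlam : IsBloch N (⇑χ) lam := isBloch_cfgL χ v
  have hω : IsBloch 1 (⇑χ) ω := isBloch_cfgW χ v
  refine ⟨?_, ?_⟩
  · have hR : IsBloch N (⇑χ) (fun x => codiff₁ (dz (codiff₁ (dz lam))) x - bsAdj N ω x) :=
      isBloch_sub (isBloch_lapN (isBloch_lapN hlam)) (isBloch_bsAdj hω)
    have h0 := isBloch_eq_zero_of_box hR (fun z => by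
      have := hres (Sum.inl z)
      rw [residB_inl, hEL0] at this
      simp only [bsAdj_apply, quo_repZ]
      exact this)
    intro x
    have := congrArg (fun f => f x) h0
    simp only [Pi.zero_apply, bsAdj_apply] at this
    exact sub_eq_zero.1 this
  · have hM0 : blockSum N lam 0 = rhs (Sum.inr ()) := by
      have := hres (Sum.inr ()); rwa [residB_inr] at this
    intro y
    have h1 := (isBloch_one_iff'.1 (isBloch_blockSum hlam)) 0 y
    rw [zero_add, hM0] at h1
    exact h1

/-- **INJECTIVITY OF EVERY UNITARY FIBRE**: for a multiplicative unitary `χ`, a box-coordinate vector in the kernel of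
the fibre map is zero.  Proof: `L (L λ)` is constant on the box (`= ω 0`) and `λ` has zero box sum, so `λ` is
discrete-harmonic (`lap_eq_zero_of_gauge`: `⟨λ, L²λ⟩_box = 0 = ‖Lλ‖²_box`), Bloch, of zero box sum, hence `0`; then
`ω 0 = L (L 0) 0 = 0`. [folklore] -/
theorem eq_zero_of_fibreLinB_eq_zero (hχ : ∀ a, ‖χ a‖ = 1) {v : IdxS d N → ℂ} (h : fibreLinB (⇑χ) v = 0) :
    v = 0 := by
  obtain ⟨hEL, hM⟩ := solves_of_fibreLinB_eq χ (v := v) (rhs := 0) h (fun _ => rfl)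
  set lam := cfgL (tensS (⇑χ) v) with hlamdef
  set ω := cfgW (tensS (⇑χ) v) with hωdef
  have hlam : IsBloch N (⇑χ) lam := isBloch_cfgL χ v
  have hbsum : bsum N lam = 0 := by
    rw [← blockSum_zero_eq_bsum]; have := hM 0; simpa using this
  have hq0 : quo N (0 : AffineAveraging.Site d) = 0 := by
    have := quo_repZ (N := N) (0 : TorusSite d N); rwa [repZ_zero] at this
  have hconst : ∀ z : TorusSite d N,
      codiff₁ (dz (codiff₁ (dz lam))) (repZ z) = codiff₁ (dz (codiff₁ (dz lam))) 0 := by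
    intro z; rw [hEL, hEL, quo_repZ, hq0]
  have hlap : ∀ x, LatticeForm.lap lam x = 0 := lap_eq_zero_of_gauge hχ hlam hbsum hconst
  have hlam0 : lam = 0 := eq_zero_of_lap_of_bsum hχ hlam hlap hbsum
  have hω0 : ω 0 = 0 := by
    have h1 := hEL 0
    have h2 : codiff₁ (dz (codiff₁ (dz lam))) 0 = 0 := by
      rw [hlam0]; simp [codiff₁, dz]
    rw [h2, hq0] at h1
    exact h1.symm
  funext i
  rcases i with z | u
  · rw [← cfgL_repZ χ v z]
    show lam (repZ z) = 0
    rw [hlam0]; rfl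
  · rw [show u = () from rfl, ← cfgW_zero χ v]
    exact hω0

/-- The fibre map of a unitary character is injective. [folklore] -/
theorem fibreLinB_injective (hχ : ∀ a, ‖χ a‖ = 1) : Function.Injective (fibreLinB (N := N) (⇑χ)) :=
  (injective_iff_map_eq_zero _).2 fun _ hv => eq_zero_of_fibreLinB_eq_zero χ hχ hv

/-- … hence the fibre matrix is invertible. [folklore] -/
theorem isUnit_fibreMatrixB (hχ : ∀ a, ‖χ a‖ = 1) : IsUnit (fibreMatrixB (N := N) (⇑χ)) := by
  rw [← Matrix.mulVec_injective_iff_isUnit]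
  intro v w hvw
  apply fibreLinB_injective χ hχ
  simpa only [fibreLinB_apply, fibreMatrixB_mulVec] using hvw

/-- … and has non-zero determinant. [folklore] -/
theorem det_fibreMatrixB_ne_zero (hχ : ∀ a, ‖χ a‖ = 1) : (fibreMatrixB (N := N) (⇑χ)).det ≠ 0 :=
  isUnit_iff_ne_zero.1 ((Matrix.isUnit_iff_isUnit_det _).1 (isUnit_fibreMatrixB χ hχ))

end Character

/-! ## §4 Locality and the block operator -/

section Locality

variable [NeZero N] {U U' : CfgS d N}

omit [NeZero N] in
/-- `L = codiff₁ ∘ dz` has fine range one: it lowers the agreement radius by one. [folklore] -/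
theorem agree_lapN {r : ℕ} {f g : Form0 d ℂ} {x : AffineAveraging.Site d} (h : Agree (r + 1) f g x) :
    Agree r (codiff₁ (dz f)) (codiff₁ (dz g)) x := by
  intro t ht
  simp only [codiff₁, dz]
  refine Finset.sum_congr rfl (fun l _ => ?_)
  rw [show x + t - unitVec l + unitVec l = x + t by abel, show x + t - unitVec l = x - unitVec l + t by abel,
    show x + t + unitVec l = x + unitVec l + t by abel, (h.sub_unitVec l) t ht, (h.add_unitVec l) t ht, h.mono t ht]

/-- EL entry, `L²` part. [folklore] -/
theorem lapLapN_congr (h : ∀ q ∈ stencil d, U q = U' q) (z : TorusSite d N) :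
    codiff₁ (dz (codiff₁ (dz (cfgL U)))) (repZ z) = codiff₁ (dz (codiff₁ (dz (cfgL U')))) (repZ z) := by
  have h3 : Agree (1 + 1 + 1) (cfgL U) (cfgL U') (repZ z) := agree_cfgL h z
  exact (agree_lapN (agree_lapN h3)).self

/-- **LOCALITY**: the residual on the box of the origin reads the configuration on the stencil cube only. [folklore] -/
theorem cfgFunB_congr (h : ∀ q ∈ stencil d, U q = U' q) : cfgFunB U = cfgFunB U' := by
  funext i
  rcases i with z | u
  · simp only [cfgFunB, residB_inl]
    rw [lapLapN_congr h, cfgW_zero_congr h]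
  · simp only [cfgFunB, residB_inr]
    exact blockSumS_congr h

end Locality

section Symbol

variable [NeZero N]

/-- The matrix of the one-offset piece `q`. [folklore] -/
def pieceMatrixB (q : AffineAveraging.Site d) : Matrix (IdxS d N) (IdxS d N) ℂ := fibreMatrixB (delta q)

/-- **THE BLOCK OPERATOR**: `cfgFunB U = Σ_{q ∈ [−3,3]^d} L_q (U q)`. [folklore] -/
theorem cfgFunB_eq_sum (U : CfgS d N) : cfgFunB U = ∑ q ∈ stencil d, (pieceMatrixB q).mulVec (U q) := by
  rw [cfgFunB_congr (cfgS_eq_sum_tens_on_stencil U), cfgFunB_finset_sum]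
  refine Finset.sum_congr rfl (fun q _ => ?_)
  show fibreFunB (delta q) (U q) = (pieceMatrixB q).mulVec (U q)
  rw [pieceMatrixB, fibreMatrixB_mulVec]

/-- Symbol form of the fibre map. [folklore] -/
theorem fibreFunB_eq_sum (c : AffineAveraging.Site d → ℂ) (v : IdxS d N → ℂ) :
    fibreFunB c v = ∑ q ∈ stencil d, c q • (pieceMatrixB q).mulVec v := by
  rw [fibreFunB, cfgFunB_eq_sum]
  refine Finset.sum_congr rfl (fun q _ => ?_)
  rw [show tensS c v q = c q • v from by funext i; simp [tensS, smul_eq_mul], Matrix.mulVec_smul]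

/-- Symbol form of the fibre matrix: `𝕃(c) = Σ_q c q • L_q`. [folklore] -/
theorem fibreMatrixB_eq_sum (c : AffineAveraging.Site d → ℂ) :
    fibreMatrixB (N := N) c = ∑ q ∈ stencil d, c q • pieceMatrixB q := by
  apply Matrix.toLin'.injective
  apply LinearMap.ext; intro v
  rw [Matrix.toLin'_apply, Matrix.toLin'_apply, fibreMatrixB_mulVec, fibreFunB_eq_sum, Matrix.sum_mulVec]
  refine Finset.sum_congr rfl (fun q _ => ?_)
  rw [Matrix.smul_mulVec]

/-- The trigonometric-polynomial symbol. [folklore] -/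
theorem fibreMatrixB_blochChar (p : Fin d → ℂ) :
    fibreMatrixB (N := N) (⇑(blochChar p)) = ∑ q ∈ stencil d, Complex.exp (Complex.I * ∑ μ, p μ * (q μ : ℂ)) • pieceMatrixB q :=
  fibreMatrixB_eq_sum _

/-- Non-singularity on the real torus. [folklore] -/
theorem det_fibreMatrixB_blochChar_ne_zero (p : Fin d → ℝ) :
    (fibreMatrixB (N := N) (⇑(blochChar (fun μ => (p μ : ℂ))))).det ≠ 0 :=
  det_fibreMatrixB_ne_zero _ (norm_blochChar_real p)

end Symbol

/-! ## §5 Translation covariance -/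

section Translate

variable [NeZero N]

/-- **THE BLOCK OPERATOR AT BLOCK `y`**: `cfgFunB (shiftCfgS U y) = Σ_a L_a (U (y + a))`. [folklore] -/
theorem cfgFunB_shiftCfgS_eq_sum (U : CfgS d N) (y : AffineAveraging.Site d) :
    cfgFunB (shiftCfgS U y) = ∑ a ∈ stencil d, (pieceMatrixB a).mulVec (U (y + a)) :=
  cfgFunB_eq_sum _

/-- EL rows at block `y`. [folklore] -/
theorem cfgFunB_shiftCfgS_inl (U : CfgS d N) (y : AffineAveraging.Site d) (z : TorusSite d N) :
    cfgFunB (shiftCfgS U y) (Sum.inl z)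
      = codiff₁ (dz (codiff₁ (dz (cfgL U)))) (repZ z + (N : ℤ) • y) - cfgW U y := by
  have hL : cfgL (shiftCfgS U y) = fun x => cfgL U (x + (N : ℤ) • y) := by
    funext x; exact cfgL_shiftCfgS U y x
  have h1 : codiff₁ (dz (fun x => cfgL U (x + (N : ℤ) • y))) = fun x => codiff₁ (dz (cfgL U)) (x + (N : ℤ) • y) :=
    funext (fun x => lapN_translate _ _ x)
  simp only [cfgFunB, residB_inl]
  rw [hL, h1, lapN_translate, cfgW_shiftCfgS, zero_add]

/-- The M row at block `y`. [folklore] -/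
theorem cfgFunB_shiftCfgS_inr (U : CfgS d N) (y : AffineAveraging.Site d) (u : Unit) :
    cfgFunB (shiftCfgS U y) (Sum.inr u) = blockSum N (cfgL U) y := by
  have hL : cfgL (shiftCfgS U y) = fun x => cfgL U (x + (N : ℤ) • y) := by
    funext x; exact cfgL_shiftCfgS U y x
  simp only [cfgFunB, residB_inr]
  rw [hL, blockSum_translate]

end Translate

/-! ## §6 Junction with `FibreInverseDecay` (dimension `d + 1`): the fundamental configuration -/

section Junction

variable [NeZero N]

/-- `fibreMatrixB (blochChar p)` IS `trigPolySymbol (stencil (d+1)) pieceMatrixB p`. [folklore] -/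
theorem fibreMatrixB_blochChar_eq_trigPolySymbol (p : Fin (d + 1) → ℂ) :
    fibreMatrixB (N := N) (⇑(blochChar p)) = trigPolySymbol (stencil (d + 1)) (pieceMatrixB (N := N)) p := by
  rw [fibreMatrixB_blochChar]
  simp only [FibreInverseDecay.trigPolySymbol, FibreInverseDecay.cphase]

/-- The symbol is non-singular at every real momentum. [folklore] -/
theorem det_trigPolySymbolB_ne_zero (s : Fin (d + 1) → ℝ) :
    (trigPolySymbol (stencil (d + 1)) (pieceMatrixB (N := N)) (ofRealVec s)).det ≠ 0 := by
  rw [← fibreMatrixB_blochChar_eq_trigPolySymbol]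
  exact det_fibreMatrixB_blochChar_ne_zero s

/-- Decay of the inverse kernel in the `ℓ¹` norm (rate and constant depend on `N`). [folklore] -/
theorem invKernelB_decay_l1 :
    ∃ δ M : ℝ, 0 < δ ∧ 0 ≤ M ∧ ∀ i j (x : Fin (d + 1) → ℤ),
      ‖invKernel (stencil (d + 1)) (pieceMatrixB (N := N)) x i j‖ ≤ M * Real.exp (-(δ * ∑ μ, |(x μ : ℝ)|)) :=
  FibreInverseDecay.invKernel_decay_l1 _ _ (fun s _ => det_trigPolySymbolB_ne_zero s)

/-- The fundamental-solution identity for the squared-Laplacian system. [folklore] -/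
theorem fibreB_fundamental_left (x : Fin (d + 1) → ℤ) :
    ∑ a ∈ stencil (d + 1), pieceMatrixB (N := N) a * invKernel (stencil (d + 1)) (pieceMatrixB (N := N)) (x + a)
      = if x = 0 then 1 else 0 :=
  FibreInverseDecay.fundamental_left _ _ (fun s _ => det_trigPolySymbolB_ne_zero s) x

/-- THE FUNDAMENTAL CONFIGURATION with source `e`. [folklore] -/
def fundCfgB (e : IdxS (d + 1) N → ℂ) : CfgS (d + 1) N :=
  fun q => (invKernel (stencil (d + 1)) (pieceMatrixB (N := N)) q).mulVec e

/-- **THE FUNDAMENTAL CONFIGURATION SOLVES THE BLOCK SYSTEM WITH A DELTA SOURCE.** [folklore] -/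
theorem cfgFunB_fundCfgB (e : IdxS (d + 1) N → ℂ) (y : AffineAveraging.Site (d + 1)) :
    cfgFunB (shiftCfgS (fundCfgB (N := N) e) y) = if y = 0 then e else 0 := by
  rw [cfgFunB_shiftCfgS_eq_sum]
  have : ∀ a ∈ stencil (d + 1), (pieceMatrixB (N := N) a).mulVec (fundCfgB e (y + a))
      = (pieceMatrixB (N := N) a * invKernel (stencil (d + 1)) (pieceMatrixB (N := N)) (y + a)).mulVec e := by
    intro a _
    simp only [fundCfgB]
    rw [Matrix.mulVec_mulVec]
  rw [Finset.sum_congr rfl this, ← Matrix.sum_mulVec, fibreB_fundamental_left]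
  split_ifs
  · exact Matrix.one_mulVec e
  · exact Matrix.zero_mulVec e

/-- EL rows read back on `ℤ^{d+1}` for an ARBITRARY source. [folklore] -/
theorem fundCfgB_EL (e : IdxS (d + 1) N → ℂ) (x : AffineAveraging.Site (d + 1)) :
    codiff₁ (dz (codiff₁ (dz (cfgL (fundCfgB (N := N) e))))) x - cfgW (fundCfgB (N := N) e) (quo N x)
      = if quo N x = 0 then e (Sum.inl (Torus.proj N x)) else 0 := by
  have hx : x = repZ (Torus.proj N x) + (N : ℤ) • quo N x := eq_repZ_add_zsmul_quo x
  have h := congr_fun (cfgFunB_fundCfgB (N := N) e (quo N x)) (Sum.inl (Torus.proj N x))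
  rw [cfgFunB_shiftCfgS_inl, ← hx] at h
  rw [h]
  split_ifs <;> rfl

/-- The M rows read back: block sums. [folklore] -/
theorem fundCfgB_M (e : IdxS (d + 1) N → ℂ) (y : AffineAveraging.Site (d + 1)) :
    blockSum N (cfgL (fundCfgB (N := N) e)) y = if y = 0 then e (Sum.inr ()) else 0 := by
  have h := congr_fun (cfgFunB_fundCfgB (N := N) e y) (Sum.inr ())
  rw [cfgFunB_shiftCfgS_inr] at h
  rw [h]
  split_ifs <;> rfl

end Junction

/-! ## §7 The kernel with a unit force at a fine site of block `0`: identities -/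

section Green

variable [NeZero N]

/-- The complex fine field of the force column. [folklore] -/
def scolL (z₀ : TorusSite (d + 1) N) : Form0 (d + 1) ℂ := cfgL (fundCfgB (N := N) (srcS z₀))

/-- Its complex multiplier. [folklore] -/
def scolW (z₀ : TorusSite (d + 1) N) : Form0 (d + 1) ℂ := cfgW (fundCfgB (N := N) (srcS z₀))

/-- COLUMN IDENTITY (EL_b): `L (L λ) x = ω (quo N x) + δ_{x, repZ z₀}`. [folklore] -/
theorem scolL_EL (z₀ : TorusSite (d + 1) N) (x : AffineAveraging.Site (d + 1)) :
    codiff₁ (dz (codiff₁ (dz (scolL (N := N) z₀)))) x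
      = scolW (N := N) z₀ (quo N x) + (if x = repZ z₀ then 1 else 0) := by
  have h := fundCfgB_EL (N := N) (srcS z₀) x
  rw [srcS_inl] at h
  have hδ : (if quo N x = 0 then (if Torus.proj N x = z₀ then (1 : ℂ) else 0) else 0)
      = if x = repZ z₀ then 1 else 0 := by
    have key : x = repZ z₀ ↔ quo N x = 0 ∧ Torus.proj N x = z₀ := eq_repZ_iff (N := N) x z₀
    by_cases hq : quo N x = 0 <;> by_cases hp : Torus.proj N x = z₀ <;> simp [hq, hp, key]
  rw [hδ] at h
  simp only [scolL, scolW]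
  linear_combination h

/-- COLUMN IDENTITY (M_b): the force column has ZERO block sums. [folklore] -/
theorem scolL_M (z₀ : TorusSite (d + 1) N) (y : AffineAveraging.Site (d + 1)) :
    blockSum N (scolL (N := N) z₀) y = 0 := by
  have h := fundCfgB_M (N := N) (srcS z₀) y
  rw [srcS_inr] at h
  simp only [scolL]
  rw [h]; split_ifs <;> rfl

omit [NeZero N] in
/-- `Re` commutes with `L = codiff₁ ∘ dz`. [folklore] -/
theorem re0_lapN (f : Form0 (d + 1) ℂ) : re0 (codiff₁ (dz f)) = codiff₁ (dz (re0 f)) := by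
  rw [re0_codiff₁, re1_dz]

/-- THE REAL KERNEL COLUMN `sB z₀ := Re λ` of the force column. [folklore] -/
def sB (z₀ : TorusSite (d + 1) N) : Form0 (d + 1) ℝ := re0 (scolL (N := N) z₀)

/-- Its real multiplier. [folklore] -/
def wB (z₀ : TorusSite (d + 1) N) : Form0 (d + 1) ℝ := re0 (scolW (N := N) z₀)

/-- (EL_b) for the real column: `L (L (sB z₀)) x = wB z₀ (quo N x) + δ_{x, repZ z₀}`. [folklore] -/
theorem sB_EL (z₀ : TorusSite (d + 1) N) (x : AffineAveraging.Site (d + 1)) :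
    codiff₁ (dz (codiff₁ (dz (sB (N := N) z₀)))) x = wB (N := N) z₀ (quo N x) + (if x = repZ z₀ then 1 else 0) := by
  have h := congrArg Complex.re (scolL_EL (N := N) z₀ x)
  have h1 : (codiff₁ (dz (codiff₁ (dz (scolL (N := N) z₀)))) x).re
      = codiff₁ (dz (codiff₁ (dz (sB (N := N) z₀)))) x := by
    have := congr_fun (re0_lapN (codiff₁ (dz (scolL (N := N) z₀)))) x
    rw [re0_apply] at this
    rw [this, re0_lapN]; rfl
  rw [h1, Complex.add_re] at h
  rw [h]
  simp only [wB, re0_apply]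
  split_ifs <;> simp

/-- (M_b) for the real column: zero block sums. [folklore] -/
theorem sB_M (z₀ : TorusSite (d + 1) N) (y : AffineAveraging.Site (d + 1)) : blockSum N (sB (N := N) z₀) y = 0 := by
  have h := congrArg Complex.re (scolL_M (N := N) z₀ y)
  rw [Complex.zero_re] at h
  rw [sB, ← re0_blockSum, re0_apply]
  exact h

end Green

/-! ## §8 Decay at fixed `N` -/

section Decay

variable [NeZero N]

/-- Decay of the force columns in the block index, uniformly in the source, AT FIXED `N`. [folklore] -/
theorem fundCfgB_srcS_decay :
    ∃ δ M : ℝ, 0 < δ ∧ 0 ≤ M ∧ ∀ (z₀ : TorusSite (d + 1) N) (q : AffineAveraging.Site (d + 1)) (i : IdxS (d + 1) N),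
      ‖fundCfgB (N := N) (srcS z₀) q i‖ ≤ M * Real.exp (-(δ * l1 q)) := by
  obtain ⟨δ, M, hδ, hM, h⟩ := invKernelB_decay_l1 (N := N) (d := d)
  refine ⟨δ, M, hδ, hM, fun z₀ q i => ?_⟩
  simp only [fundCfgB, mulVec_srcS]
  exact h i _ q

/-- **DECAY OF THE KERNEL COLUMN** from the origin (`Decay510` shape), uniformly in the source, AT FIXED `N`: witnesses
`δ_N = δ / N`, `C_N = M e^{δ(d+1)}`; no uniformity in `N` claimed. [folklore] -/
theorem decay_sB : ∃ δ C : ℝ, 0 < δ ∧ 0 ≤ C ∧ ∀ (z₀ : TorusSite (d + 1) N), Decay510 (sB (N := N) z₀) C δ := by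
  obtain ⟨δ, M, hδ, hM, h⟩ := fundCfgB_srcS_decay (N := N) (d := d)
  have hN : (0 : ℝ) < N := by exact_mod_cast Nat.pos_of_ne_zero (NeZero.ne N)
  refine ⟨δ / N, M * Real.exp (δ * (d + 1)), div_pos hδ hN, by positivity, fun z₀ z => ?_⟩
  calc |sB (N := N) z₀ z| ≤ ‖scolL (N := N) z₀ z‖ := Complex.abs_re_le_norm _
    _ = ‖fundCfgB (N := N) (srcS z₀) (quo N z) (Sum.inl (Torus.proj N z))‖ := rfl
    _ ≤ M * Real.exp (-(δ * l1 (quo N z))) := h z₀ _ _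
    _ ≤ M * (Real.exp (δ * (d + 1)) * Real.exp (-(δ / N) * l1 z)) :=
        mul_le_mul_of_nonneg_left (exp_quo_le (N := N) hδ z) hM
    _ = M * Real.exp (δ * (d + 1)) * Real.exp (-(δ / N) * l1 z) := by ring

/-- **DECAY OF THE MULTIPLIER COLUMN** (a coarse field: decay in the block index), AT FIXED `N`. [folklore] -/
theorem decay_wB : ∃ δ C : ℝ, 0 < δ ∧ 0 ≤ C ∧ ∀ (z₀ : TorusSite (d + 1) N), Decay510 (wB (N := N) z₀) C δ := by
  obtain ⟨δ, M, hδ, hM, h⟩ := fundCfgB_srcS_decay (N := N) (d := d)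
  refine ⟨δ, M, hδ, hM, fun z₀ y => ?_⟩
  calc |wB (N := N) z₀ y| ≤ ‖scolW (N := N) z₀ y‖ := Complex.abs_re_le_norm _
    _ = ‖fundCfgB (N := N) (srcS z₀) y (Sum.inr ())‖ := rfl
    _ ≤ M * Real.exp (-(δ * l1 y)) := h z₀ _ _
    _ = M * Real.exp (-δ * l1 y) := by rw [neg_mul]

end Decay

/-! ## §9 Arbitrary source site by block translation (taken as the definition) -/

section Translate2

variable [NeZero N]

/-- THE KERNEL `Sb x x'`: the field at `x` of the solution of (EL_b)/(M_b) with a unit force at the fine site `x'`,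
defined from the block-`0` columns by block translation. [folklore] -/
def Sb (x x' : AffineAveraging.Site (d + 1)) : ℝ := sB (N := N) (Torus.proj N x') (x - (N : ℤ) • quo N x')

/-- Its coarse multiplier `Wb y x'`. [folklore] -/
def Wb (y x' : AffineAveraging.Site (d + 1)) : ℝ := wB (N := N) (Torus.proj N x') (y - quo N x')

/-- (EL_b) for the kernel: `L (L (Sb · x')) x = Wb (quo N x) x' + δ_{x x'}`. [folklore] -/
theorem Sb_EL (x' x : AffineAveraging.Site (d + 1)) :
    codiff₁ (dz (codiff₁ (dz (fun z => Sb (N := N) z x')))) x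
      = Wb (N := N) (quo N x) x' + (if x = x' then 1 else 0) := by
  have h := sB_EL (N := N) (Torus.proj N x') (x - (N : ℤ) • quo N x')
  have hq : quo N (x - (N : ℤ) • quo N x') = quo N x - quo N x' := by
    rw [sub_eq_add_neg, ← smul_neg, quo_add_zsmul, ← sub_eq_add_neg]
  have e4 : (x - (N : ℤ) • quo N x' = repZ (Torus.proj N x')) ↔ x = x' := by
    rw [sub_eq_iff_eq_add, ← eq_repZ_add_zsmul_quo (N := N) x']
  have e0 : codiff₁ (dz (fun z => Sb (N := N) z x'))
      = fun z => codiff₁ (dz (sB (N := N) (Torus.proj N x'))) (z - (N : ℤ) • quo N x') := by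
    funext z; simp only [Sb]; exact lapN_shiftS _ _ z
  have e1 : codiff₁ (dz (codiff₁ (dz (fun z => Sb (N := N) z x')))) x
      = codiff₁ (dz (codiff₁ (dz (sB (N := N) (Torus.proj N x'))))) (x - (N : ℤ) • quo N x') := by
    rw [e0]; exact lapN_shiftS _ _ x
  rw [e1, h, hq]
  simp only [Wb, e4]

/-- (M_b) for the kernel: zero block sums in the field variable. [folklore] -/
theorem Sb_M (x' y : AffineAveraging.Site (d + 1)) : blockSum N (fun z => Sb (N := N) z x') y = 0 := by
  simp only [Sb]
  rw [blockSum_shift, sB_M]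

/-- **DECAY OF THE KERNEL** in `|x − x'|₁`, AT FIXED `N`. [folklore] -/
theorem decay_Sb : ∃ δ C : ℝ, 0 < δ ∧ 0 ≤ C ∧ ∀ (x x' : AffineAveraging.Site (d + 1)),
    |Sb (N := N) x x'| ≤ C * Real.exp (-δ * l1 (x - x')) := by
  obtain ⟨δ, C, hδ, hC, h⟩ := decay_sB (N := N) (d := d)
  refine ⟨δ, C * Real.exp (δ * ((N : ℝ) * (d + 1))), hδ, by positivity, fun x x' => ?_⟩
  have hx' : x' = repZ (Torus.proj N x') + (N : ℤ) • quo N x' := eq_repZ_add_zsmul_quo x'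
  have hsplit : x - x' = (x - (N : ℤ) • quo N x') - repZ (Torus.proj N x') := by
    conv_lhs => rw [hx']
    abel
  have hl1 : l1 (x - x') ≤ l1 (x - (N : ℤ) • quo N x') + (N : ℝ) * (d + 1) := by
    rw [hsplit]
    exact (l1_sub_le _ _).trans (by linarith [l1_repZ_le (N := N) (Torus.proj N x')])
  have hdec := h (Torus.proj N x') (x - (N : ℤ) • quo N x')
  calc |Sb (N := N) x x'| = |sB (N := N) (Torus.proj N x') (x - (N : ℤ) • quo N x')| := rfl
    _ ≤ C * Real.exp (-δ * l1 (x - (N : ℤ) • quo N x')) := hdec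
    _ ≤ C * (Real.exp (δ * ((N : ℝ) * (d + 1))) * Real.exp (-δ * l1 (x - x'))) := by
        refine mul_le_mul_of_nonneg_left ?_ hC
        rw [← Real.exp_add]
        exact Real.exp_le_exp.2 (by nlinarith)
    _ = C * Real.exp (δ * ((N : ℝ) * (d + 1))) * Real.exp (-δ * l1 (x - x')) := by ring

end Translate2

end

end Literature.MathematicalPhysics.QuantumFieldTheory.Balaban1983to89.Beta.BiLaplaceBlockKKT
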